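import Mathlib.Analysis.Calculus.IteratedDeriv.Lemmas
import Mathlib.Analysis.Calculus.ContDiff.Deriv
import Mathlib.Analysis.Calculus.Deriv.MeanValue
import Mathlib.Analysis.Calculus.LocalExtr.Basic
import Mathlib.Analysis.SpecialFunctions.SmoothTransition
import Mathlib.MeasureTheory.Integral.IntegralEqImproper
import Mathlib.MeasureTheory.Measure.Haar.NormedSpace
import HarnessLib
import HarnessLib.Audit

/-!
# One-dimensional profile integrals `J(b; p,q,r) = ∫ b⁽ᵖ⁾ b⁽ᵠ⁾ b⁽ʳ⁾`

Search for candidate a priori estimates; no regularity claim. NS FUNCTIONAL MINING — NO-GO BRANCH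
(pub-nsfunc-nogo); one-dimensional toolkit for the explicit Euclidean enstrophy-production witness
(`NoGo/EnstrophyBudgetWitness.lean`).

For a smooth profile `b : ℝ → ℝ` and an index triple `p = (p₁,p₂,p₃)` we set
`tri b p (t) = b⁽ᵖ¹⁾(t) b⁽ᵖ²⁾(t) b⁽ᵖ³⁾(t)` and `J b p = ∫ tri b p`.  Proved here (all folklore calculus):
* parity: `J b p = 0` when `b` is even and `p₁+p₂+p₃` is odd (`J_eq_zero_of_odd`);
* scaling: `J (b(β·)) p = β^{p₁+p₂+p₃} β⁻¹ J b p` for `β > 0` (`J_scale`);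
* integration by parts in the form `J(p₁+1,p₂,p₃) + J(p₁,p₂+1,p₃) + J(p₁,p₂,p₃+1) = 0` for compactly
  supported `b` (`J_shift`);
* a concrete even bump `bumpA (t) = smoothTransition (2+t) · smoothTransition (2−t)` (`= 1` on `[-1,1]`,
  `= 0` off `(-2,2)`) with `0 < ∫ b b'²` and `0 < ∫ b b''²` (`bumpA.P2_pos`, `bumpA.P4_pos`, by the
  mean value theorem — no numerical evaluation of any integral).
Nothing is asserted about Navier–Stokes.
-/

open MeasureTheory Set Function
open scoped ContDiff

namespace Summit.NavierStokesRegularity.FunctionalMining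

namespace Sep3

/-- `∞ ≠ 0` in `WithTop ℕ∞` (smoothness-order bookkeeping). [folklore] -/
private theorem infty_ne_zero : (∞ : WithTop ℕ∞) ≠ 0 := by simp

/-- `m ≤ ∞` in `WithTop ℕ∞` for a natural number `m`. [folklore] -/
private theorem natCast_le_infty (m : ℕ) : (m : WithTop ℕ∞) ≤ ∞ := by exact_mod_cast le_top

/-- Index triples `(p₁, p₂, p₃)` of derivative orders. [folklore] -/
abbrev Idx : Type := ℕ × ℕ × ℕ

/-- Total order `p₁ + p₂ + p₃` of an index triple. [folklore] -/
@[simp] def Idx.wt (p : Idx) : ℕ := p.1 + p.2.1 + p.2.2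

/-! ## Iterated derivatives of a smooth profile -/

section OneD

variable {ψ : ℝ → ℝ}

/-- Iterated derivatives of a smooth function are smooth. [folklore] -/
theorem contDiff_iteratedDeriv (hψ : ContDiff ℝ ∞ ψ) (k : ℕ) :
    ContDiff ℝ ∞ (iteratedDeriv k ψ) := by
  rw [iteratedDeriv_eq_iterate]; exact hψ.iterate_deriv k

/-- `(ψ⁽ᵏ⁾)' = ψ⁽ᵏ⁺¹⁾` pointwise, as a `HasDerivAt` statement. [folklore] -/
theorem hasDerivAt_iteratedDeriv (hψ : ContDiff ℝ ∞ ψ) (k : ℕ) (t : ℝ) :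
    HasDerivAt (iteratedDeriv k ψ) (iteratedDeriv (k + 1) ψ t) t := by
  rw [iteratedDeriv_succ]
  exact (((contDiff_iteratedDeriv hψ k).differentiable infty_ne_zero) t).hasDerivAt

/-- If `ψ` vanishes on the open set `{t | R < |t|}`, so do all its iterated derivatives. [folklore] -/
theorem iteratedDeriv_eq_zero_of_abs_lt {R : ℝ} (h0 : ∀ t, R < |t| → ψ t = 0) (k : ℕ) :
    ∀ t, R < |t| → iteratedDeriv k ψ t = 0 := by
  induction k with
  | zero => simpa using h0
  | succ k ih =>
      intro t ht
      rw [iteratedDeriv_succ]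
      have hopen : IsOpen {s : ℝ | R < |s|} := isOpen_lt continuous_const continuous_abs
      have hev : (iteratedDeriv k ψ) =ᶠ[nhds t] (fun _ => (0 : ℝ)) :=
        Filter.eventuallyEq_of_mem (hopen.mem_nhds ht) fun s hs => ih s hs
      rw [hev.deriv_eq]; simp

/-- For an even function, `ψ⁽ⁿ⁾(-t) = (-1)ⁿ ψ⁽ⁿ⁾(t)`. [folklore] -/
theorem iteratedDeriv_neg_of_even (hψ : ∀ t, ψ (-t) = ψ t) (n : ℕ) (t : ℝ) :
    iteratedDeriv n ψ (-t) = (-1 : ℝ) ^ n * iteratedDeriv n ψ t := by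
  have hfun : (fun x => ψ (-x)) = ψ := funext hψ
  have h := iteratedDeriv_comp_neg n ψ (-t)
  rw [hfun, neg_neg, smul_eq_mul] at h
  exact h

end OneD

/-! ## Triple products and their integrals -/

section Tri

variable {b : ℝ → ℝ}

/-- `tri b (p₁,p₂,p₃) (t) = b⁽ᵖ¹⁾(t) · b⁽ᵖ²⁾(t) · b⁽ᵖ³⁾(t)`. [folklore] -/
noncomputable def tri (b : ℝ → ℝ) (p : Idx) (t : ℝ) : ℝ :=
  iteratedDeriv p.1 b t * iteratedDeriv p.2.1 b t * iteratedDeriv p.2.2 b t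

/-- `J b p = ∫ b⁽ᵖ¹⁾ b⁽ᵖ²⁾ b⁽ᵖ³⁾`. [folklore] -/
noncomputable def J (b : ℝ → ℝ) (p : Idx) : ℝ := ∫ t, tri b p t

/-- `tri b p` is continuous for smooth `b`. [folklore] -/
theorem continuous_tri (hb : ContDiff ℝ ∞ b) (p : Idx) : Continuous (tri b p) :=
  ((hb.continuous_iteratedDeriv _ (natCast_le_infty _)).mul
    (hb.continuous_iteratedDeriv _ (natCast_le_infty _))).mul
    (hb.continuous_iteratedDeriv _ (natCast_le_infty _))

/-- `tri b p` vanishes where `b` does (`2 < |t|`). [folklore] -/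
theorem tri_eq_zero (h0 : ∀ t, 2 < |t| → b t = 0) (p : Idx) {t : ℝ} (ht : 2 < |t|) :
    tri b p t = 0 := by
  simp [tri, iteratedDeriv_eq_zero_of_abs_lt h0 _ t ht]

/-- Outside `[-2, 2]` one has `2 < |t|`. [folklore] -/
theorem two_lt_abs_of_not_mem_Icc {t : ℝ} (ht : t ∉ Icc (-2 : ℝ) 2) : 2 < |t| := by
  rw [mem_Icc, not_and_or, not_le, not_le] at ht
  rcases ht with h | h
  · rw [lt_abs]; right; linarith
  · exact lt_of_lt_of_le h (le_abs_self t)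

/-- `tri b p` has compact support (in `[-2, 2]`). [folklore] -/
theorem hasCompactSupport_tri (h0 : ∀ t, 2 < |t| → b t = 0) (p : Idx) :
    HasCompactSupport (tri b p) :=
  HasCompactSupport.intro isCompact_Icc fun _ ht => tri_eq_zero h0 p (two_lt_abs_of_not_mem_Icc ht)

/-- `tri b p` is integrable (continuous, compactly supported). [folklore] -/
theorem integrable_tri (hb : ContDiff ℝ ∞ b) (h0 : ∀ t, 2 < |t| → b t = 0) (p : Idx) :
    Integrable (tri b p) :=
  (continuous_tri hb p).integrable_of_hasCompactSupport (hasCompactSupport_tri h0 p)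

/-- `J` is symmetric in its indices. [folklore] -/
theorem J_swap12 (b : ℝ → ℝ) (p q r : ℕ) : J b (p, q, r) = J b (q, p, r) := by
  simp only [J, tri]; congr 1; funext t; ring

/-- `J` is symmetric in its last two indices. [folklore] -/
theorem J_swap23 (b : ℝ → ℝ) (p q r : ℕ) : J b (p, q, r) = J b (p, r, q) := by
  simp only [J, tri]; congr 1; funext t; ring

/-- `J` is symmetric in its outer indices. [folklore] -/
theorem J_swap13 (b : ℝ → ℝ) (p q r : ℕ) : J b (p, q, r) = J b (r, q, p) := by
  simp only [J, tri]; congr 1; funext t; ring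

/-- PARITY: for even `b`, `J b p = 0` whenever the total order is odd. [folklore] -/
theorem J_eq_zero_of_odd (hb : ∀ t, b (-t) = b t) (p : Idx) (hp : p.wt % 2 = 1) : J b p = 0 := by
  have hsign : (-1 : ℝ) ^ p.1 * (-1) ^ p.2.1 * (-1) ^ p.2.2 = -1 := by
    rw [← pow_add, ← pow_add, Odd.neg_one_pow]
    exact Nat.odd_iff.2 (by simpa [Idx.wt] using hp)
  have hodd : ∀ t, tri b p (-t) = -tri b p t := by
    intro t
    simp only [tri, iteratedDeriv_neg_of_even hb]
    linear_combination
      (iteratedDeriv p.1 b t * iteratedDeriv p.2.1 b t * iteratedDeriv p.2.2 b t) * hsign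
  have h1 : ∫ t, tri b p ((-1 : ℝ) * t) = |(-1 : ℝ)⁻¹| • ∫ t, tri b p t :=
    Measure.integral_comp_mul_left (fun t => tri b p t) (-1)
  simp only [neg_mul, one_mul, hodd, integral_neg, inv_neg, inv_one, abs_neg, abs_one,
    one_smul] at h1
  unfold J; linarith

/-- SCALING: `J (b(β·)) p = β^{|p|} β⁻¹ J b p` for `β > 0`. [folklore] -/
theorem J_scale (hb : ContDiff ℝ ∞ b) {β : ℝ} (hβ : 0 < β) (p : Idx) :
    J (fun t => b (β * t)) p = β ^ p.wt * β⁻¹ * J b p := by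
  have hD : ∀ n : ℕ, iteratedDeriv n (fun t => b (β * t)) = fun t => β ^ n * iteratedDeriv n b (β * t) :=
    fun n => iteratedDeriv_comp_const_mul (hb.of_le (by exact_mod_cast le_top)) β
  have hpt : ∀ t, tri (fun t => b (β * t)) p t = β ^ p.wt * tri b p (β * t) := by
    intro t; simp only [tri, hD, Idx.wt, pow_add]; ring
  unfold J
  simp_rw [hpt, integral_const_mul]
  rw [Measure.integral_comp_mul_left (fun t => tri b p t) β, abs_of_pos (inv_pos.2 hβ), smul_eq_mul]
  ring

/-- Product rule for `tri`. [folklore] -/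
theorem hasDerivAt_tri (hb : ContDiff ℝ ∞ b) (p : Idx) (t : ℝ) :
    HasDerivAt (tri b p) (tri b (p.1 + 1, p.2.1, p.2.2) t + tri b (p.1, p.2.1 + 1, p.2.2) t +
      tri b (p.1, p.2.1, p.2.2 + 1) t) t := by
  have h1 := hasDerivAt_iteratedDeriv hb p.1 t
  have h2 := hasDerivAt_iteratedDeriv hb p.2.1 t
  have h3 := hasDerivAt_iteratedDeriv hb p.2.2 t
  have h := (h1.mul h2).mul h3
  refine (h.congr_deriv ?_).congr_of_eventuallyEq (Filter.Eventually.of_forall fun s => rfl)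
  simp only [tri, Pi.mul_apply]; ring

/-- INTEGRATION BY PARTS: `J(p₁+1,p₂,p₃) + J(p₁,p₂+1,p₃) + J(p₁,p₂,p₃+1) = 0`. [folklore] -/
theorem J_shift (hb : ContDiff ℝ ∞ b) (h0 : ∀ t, 2 < |t| → b t = 0) (p : Idx) :
    J b (p.1 + 1, p.2.1, p.2.2) + J b (p.1, p.2.1 + 1, p.2.2) + J b (p.1, p.2.1, p.2.2 + 1) = 0 := by
  have hI := fun q => integrable_tri hb h0 q
  have hsum : Integrable (fun t => tri b (p.1 + 1, p.2.1, p.2.2) t + tri b (p.1, p.2.1 + 1, p.2.2) t +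
      tri b (p.1, p.2.1, p.2.2 + 1) t) := ((hI _).add (hI _)).add (hI _)
  have h12 : Integrable (fun t => tri b (p.1 + 1, p.2.1, p.2.2) t + tri b (p.1, p.2.1 + 1, p.2.2) t) :=
    (hI _).add (hI _)
  have h := integral_eq_zero_of_hasDerivAt_of_integrable (hasDerivAt_tri hb p) hsum (hI p)
  rw [integral_add h12 (hI _), integral_add (hI _) (hI _)] at h
  simpa [J] using h

/-- `∫ b b b'' = -2 ∫ b b'²`. [folklore] -/
theorem J_002 (hb : ContDiff ℝ ∞ b) (h0 : ∀ t, 2 < |t| → b t = 0) :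
    J b (0, 0, 2) = -2 * J b (0, 1, 1) := by
  have h := J_shift hb h0 (0, 0, 1)
  simp only [Nat.reduceAdd, zero_add] at h
  rw [J_swap12 b 1 0 1] at h
  linarith

/-- `∫ b' b' b'' = 0`. [folklore] -/
theorem J_112 (hb : ContDiff ℝ ∞ b) (h0 : ∀ t, 2 < |t| → b t = 0) : J b (1, 1, 2) = 0 := by
  have h := J_shift hb h0 (1, 1, 1)
  simp only [Nat.reduceAdd] at h
  rw [J_swap13 b 2 1 1, J_swap23 b 1 2 1] at h
  linarith

/-- `∫ b b' b''' = -∫ b b''²`. [folklore] -/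
theorem J_013 (hb : ContDiff ℝ ∞ b) (h0 : ∀ t, 2 < |t| → b t = 0) :
    J b (0, 1, 3) = -J b (0, 2, 2) := by
  have h := J_shift hb h0 (0, 1, 2)
  simp only [Nat.reduceAdd, zero_add] at h
  rw [J_112 hb h0] at h
  linarith

/-- Positivity of `J` from a pointwise nonnegative integrand that is nonzero somewhere. [folklore] -/
theorem J_pos (hb : ContDiff ℝ ∞ b) (h0 : ∀ t, 2 < |t| → b t = 0) (p : Idx)
    (hnn : ∀ t, 0 ≤ tri b p t) {t₀ : ℝ} (ht₀ : tri b p t₀ ≠ 0) : 0 < J b p :=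
  (continuous_tri hb p).integral_pos_of_hasCompactSupport_nonneg_nonzero
    (hasCompactSupport_tri h0 p) hnn ht₀

end Tri

/-! ## A concrete even bump profile -/

/-- `bumpA (t) = smoothTransition (2 + t) · smoothTransition (2 - t)`. [folklore] -/
noncomputable def bumpA (t : ℝ) : ℝ := Real.smoothTransition (2 + t) * Real.smoothTransition (2 - t)

namespace bumpA

/-- `bumpA` is smooth. [folklore] -/
theorem contDiff : ContDiff ℝ ∞ bumpA :=
  (Real.smoothTransition.contDiff.comp (contDiff_const.add contDiff_id)).mul
    (Real.smoothTransition.contDiff.comp (contDiff_const.sub contDiff_id))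

/-- `bumpA` is even. [folklore] -/
theorem even (t : ℝ) : bumpA (-t) = bumpA t := by
  unfold bumpA
  rw [show (2 : ℝ) + -t = 2 - t by ring, show (2 : ℝ) - -t = 2 + t by ring, mul_comm]

/-- `0 ≤ bumpA`. [folklore] -/
theorem nonneg (t : ℝ) : 0 ≤ bumpA t :=
  mul_nonneg (Real.smoothTransition.nonneg _) (Real.smoothTransition.nonneg _)

/-- `bumpA ≤ 1`. [folklore] -/
theorem le_one (t : ℝ) : bumpA t ≤ 1 :=
  mul_le_one₀ (Real.smoothTransition.le_one _) (Real.smoothTransition.nonneg _)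
    (Real.smoothTransition.le_one _)

/-- `bumpA t = 0` for `2 ≤ |t|`. [folklore] -/
theorem eq_zero {t : ℝ} (ht : 2 ≤ |t|) : bumpA t = 0 := by
  unfold bumpA
  rcases le_abs'.1 ht with h | h
  · rw [Real.smoothTransition.zero_of_nonpos (by linarith : 2 + t ≤ 0), zero_mul]
  · rw [Real.smoothTransition.zero_of_nonpos (by linarith : 2 - t ≤ 0), mul_zero]

/-- `bumpA t = 0` for `2 < |t|`. [folklore] -/
theorem zero (t : ℝ) (ht : 2 < |t|) : bumpA t = 0 := eq_zero ht.le

/-- `bumpA t = 1` for `|t| ≤ 1`. [folklore] -/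
theorem eq_one {t : ℝ} (ht : |t| ≤ 1) : bumpA t = 1 := by
  unfold bumpA
  rw [abs_le] at ht
  rw [Real.smoothTransition.one_of_one_le (by linarith), Real.smoothTransition.one_of_one_le (by linarith),
    mul_one]

/-- `0 < bumpA t` for `|t| < 2`. [folklore] -/
theorem pos {t : ℝ} (ht : |t| < 2) : 0 < bumpA t := by
  unfold bumpA
  rw [abs_lt] at ht
  exact mul_pos (Real.smoothTransition.pos_of_pos (by linarith))
    (Real.smoothTransition.pos_of_pos (by linarith))

/-- `bumpA` is differentiable. [folklore] -/
theorem differentiable : Differentiable ℝ bumpA := contDiff.differentiable infty_ne_zero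

/-- `bumpA'` is differentiable. [folklore] -/
theorem differentiable_deriv : Differentiable ℝ (deriv bumpA) := by
  have h := contDiff_iteratedDeriv contDiff 1
  rw [iteratedDeriv_one] at h
  exact h.differentiable infty_ne_zero

/-- Mean value theorem: `b' = -1` somewhere in `(1, 2)`. [folklore] -/
theorem exists_deriv_eq_neg_one : ∃ c ∈ Ioo (1 : ℝ) 2, deriv bumpA c = -1 := by
  obtain ⟨c, hc, h⟩ := exists_deriv_eq_slope bumpA (by norm_num : (1 : ℝ) < 2)
    differentiable.continuous.continuousOn (differentiable.differentiableOn)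
  refine ⟨c, hc, ?_⟩
  rw [h, eq_one (by norm_num : |(1 : ℝ)| ≤ 1), eq_zero (by norm_num : (2 : ℝ) ≤ |2|)]
  norm_num

/-- `bumpA' (1) = 0` (interior maximum). [folklore] -/
theorem deriv_one : deriv bumpA 1 = 0 :=
  IsLocalMax.deriv_eq_zero
    (Filter.Eventually.of_forall fun x => (le_one x).trans_eq (eq_one (by norm_num)).symm)

end bumpA

/-- `0 < ∫ b b'²` for the concrete bump, by the mean value theorem (`b(1) = 1`, `b(2) = 0` force
`b' = -1` somewhere on `(1,2)`, where `b > 0`); no integral is evaluated. [folklore] -/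
theorem bumpA.P2_pos : 0 < J bumpA (0, 1, 1) := by
  obtain ⟨c, hc, hdc⟩ := bumpA.exists_deriv_eq_neg_one
  have hcabs : |c| < 2 := by rw [abs_lt]; constructor <;> linarith [hc.1, hc.2]
  have htri : ∀ t, tri bumpA (0, 1, 1) t = bumpA t * deriv bumpA t ^ 2 := fun t => by
    simp only [tri, iteratedDeriv_one, iteratedDeriv_zero]; ring
  refine J_pos bumpA.contDiff bumpA.zero _ (fun t => ?_) (t₀ := c) ?_
  · rw [htri]; exact mul_nonneg (bumpA.nonneg t) (sq_nonneg _)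
  · rw [htri, hdc]; norm_num; exact (bumpA.pos hcabs).ne'

/-- `0 < ∫ b b''²` for the concrete bump: `b'(1) = 0` (interior maximum) and `b'(c) = -1` force
`b'' ≠ 0` somewhere on `(1, c) ⊆ (1, 2)`, where `b > 0`; no integral is evaluated. [folklore] -/
theorem bumpA.P4_pos : 0 < J bumpA (0, 2, 2) := by
  obtain ⟨c, hc, hdc⟩ := bumpA.exists_deriv_eq_neg_one
  obtain ⟨e, he, hde⟩ := exists_deriv_eq_slope (deriv bumpA) hc.1
    bumpA.differentiable_deriv.continuous.continuousOn
    (bumpA.differentiable_deriv.differentiableOn)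
  rw [hdc, bumpA.deriv_one] at hde
  have hc1 : 0 < c - 1 := by linarith [hc.1]
  have hde' : deriv (deriv bumpA) e < 0 := by
    rw [hde]; exact div_neg_of_neg_of_pos (by norm_num) hc1
  have heabs : |e| < 2 := by rw [abs_lt]; constructor <;> linarith [he.1, he.2, hc.2]
  have h2 : iteratedDeriv 2 bumpA = deriv (deriv bumpA) := by
    rw [show (2 : ℕ) = 1 + 1 from rfl, iteratedDeriv_succ, iteratedDeriv_one]
  have htri : ∀ t, tri bumpA (0, 2, 2) t = bumpA t * iteratedDeriv 2 bumpA t ^ 2 := fun t => by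
    simp only [tri, iteratedDeriv_zero]; ring
  refine J_pos bumpA.contDiff bumpA.zero _ (fun t => ?_) (t₀ := e) ?_
  · rw [htri]; exact mul_nonneg (bumpA.nonneg t) (sq_nonneg _)
  · rw [htri, h2]
    exact mul_ne_zero (bumpA.pos heabs).ne' (pow_ne_zero 2 hde'.ne)

end Sep3

end Summit.NavierStokesRegularity.FunctionalMining
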